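import Literature.NumberTheory.GaloisRepresentations.LubinTateTorsion
import Literature.NumberTheory.EllipticCurves.PadicSeriesEvaluation
import Mathlib.RingTheory.PowerSeries.Evaluation
import HarnessLib

/-!
# Evaluation of `ℤ_p`-power series (one and two variables) at points of the open unit disc of a
# COMPLETE ultrametric normed `ℚ_p`-algebra `K`, with values in `𝒪_K` — ring homomorphism,
# compatibility with substitution, the sum formula, and the basic bounds (cell `b2b-bsdres`,
# CLASS-CLOSURE lane, class O10 — x1b GEN 33, class lead; file 21 of the local series: the
# evaluation layer under the formal group law and the formal logarithm at `ℚ̄_p`-points)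

HONEST FRAMING (cell `b2b-bsdres`, run/shared/lean/b2b/bsd-rank1-residual/, verbatim in every
file): the goal of the cell is to DELETE the COMBINATION-SHAPED residual classes of the
Birch–Swinnerton-Dyer formula for ALL analytic-rank `≤ 1` elliptic curves over `ℚ` — "full BSD
formula for every rank `≤ 1` curve in class `C`" assembled STRICTLY from published theorems — so
that the rank-`≤ 1` remainder becomes exactly the CONSTRUCTION-SHAPED classes, which are TYPED
(missing-input `Prop`s), NOT attempted. This is not "finishing BSD". CLASS-CLOSURE lane: prove
what is provable now; shrink each hard class to its core with data; no claim beyond stated classes;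
research routes on CONSTRUCTION-SHAPED X12 / O10; census / instrument output = EVIDENCE / conjecture
items, NEVER a Literature fact; `RESIDUAL-MAP.md` marks change only by signed lines. THIS FILE:
TOOL DEFINITIONS + THEOREMS (definitions with bodies: `coeffHom`, `ev`, `ev₁`; every statement
proved) — no named Literature fact, no Summits-side fact `def … : Prop`, no `sorry`, axioms
standard; nothing is booked; no label / mark / count / sub-cell moves; O10 stays OPEN /
CONSTRUCTION-SHAPED; nothing about `BSD(W, p)` of any pair is claimed.

## Why

Kobayashi's Prop. 8.11/8.12 (`hsum` of the (C3_η) chain) needs the formal group of `E` EVALUATED at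
points of `E₁` over the ramified fields `k_n = ℚ_p(ζ_{p^{n+1}})`: the group law
`z(P + Q) = F(z(P), z(Q))`, the logarithm `log(z(P))`, and Honda's isomorphism `i(ζ − 1)`. The tree's
evaluation machinery (`PadicSeriesEvaluation`) is over `ℚ_p` only (target `ℤ_p`). This file is the
same machinery with target the closed unit ball `𝒪_K` of any complete ultrametric normed
`ℚ_p`-algebra `K` (Mathlib's topological evaluation `MvPowerSeries.eval₂` into the complete
LINEARLY topologised ring `𝒪_K = unitBall K` of `LubinTateTorsion.lean`), to be applied with `K` a
finite subextension of `ℚ̄_p = PadicAlgCl p`.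

## What is here (`𝒪 = unitBall K`, `φ = coeffHom p K : ℤ_p → 𝒪`)

* §1 `coeffHom p K` (the isometric embedding `ℤ_p → 𝒪_K`), its continuity; `hasEval_of_norm_lt_one`,
  `mvHasEval_of_norm_lt_one`, `hasEval_pair` (points of the open disc are evaluable).
* §2 `ev p K b hb : MvPowerSeries τ ℤ_[p] →+* 𝒪` and `ev₁ p K t ht : ℤ_[p]⟦X⟧ →+* 𝒪` (Mathlib
  `eval₂Hom`), `ev_X`, `ev_C`, `ev₁_X`, `ev₁_C`; **substitution compatibility** `ev_subst`,
  `ev_powerSeries_subst`, `ev₁_subst` (`(f ∘ a)(b) = f(a(b))`; Bourbaki, *Algèbre* IV §4 no. 3: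
  both sides are continuous in `f` and agree on polynomials — the tree's
  `mvPowerSeries_continuous_subst` and Mathlib's `eval₂_unique`).
* §3 the sum formula in `K` (`hasSum_ev₁`: `∑ φ(fₙ) tⁿ`), and the bounds `‖ev₁ f t‖ ≤ 1`,
  `‖ev₁ f t‖ ≤ ‖t‖` for `f(0) = 0`, `‖ev f (u,v)‖ ≤ max ‖u‖ ‖v‖` for `f(0) = 0`.

References: N. Bourbaki, *Algèbre*, Ch. IV §4 no. 3; [SilvermanAEC2009] IV.1 ("the power series …
converge for `z ∈ 𝓜`"); [CasselsFrohlichANT1967] Ch. VI §3.2 (`F(𝔪_K)`).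
-/

noncomputable section

open scoped Classical Topology
open Filter MvPowerSeries PowerSeries MvPowerSeries.WithPiTopology PowerSeries.WithPiTopology

namespace Summit.BirchSwinnertonDyer.Rank1Residual.Additive

namespace BallEval

open Literature.NumberTheory.GaloisRepresentations.LubinTate (unitBall mem_unitBall_iff
  isTopologicallyNilpotent_of_norm_lt_one)
open Literature.NumberTheory.EllipticCurves (mvPowerSeries_continuous_subst)

variable (p : ℕ) [hp : Fact p.Prime] (K : Type*) [NontriviallyNormedField K] [NormedAlgebra ℚ_[p] K]
  [IsUltrametricDist K] [CompleteSpace K]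

/-! ## §1 The coefficient map `ℤ_p → 𝒪_K` and evaluable points -/

omit [IsUltrametricDist K] [CompleteSpace K] in
/-- `‖q‖_K = ‖q‖_p` for `q ∈ ℚ_p` mapped into the normed `ℚ_p`-algebra `K`. [folklore] -/
theorem norm_algebraMap_padic (q : ℚ_[p]) : ‖algebraMap ℚ_[p] K q‖ = ‖q‖ :=
  norm_algebraMap' K q

/-- **The coefficient map `ℤ_p → 𝒪_K`** (`ℤ_p ⊂ ℚ_p → K` lands in the closed unit ball).
[cite: CasselsFrohlichANT1967, Ch. VI §3.2] -/
def coeffHom : ℤ_[p] →+* unitBall K :=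
  ((algebraMap ℚ_[p] K).comp (PadicInt.Coe.ringHom (p := p))).codRestrict (unitBall K) fun x => by
    rw [mem_unitBall_iff]
    change ‖algebraMap ℚ_[p] K (x : ℚ_[p])‖ ≤ 1
    rw [norm_algebraMap_padic]
    exact PadicInt.norm_le_one x

omit [CompleteSpace K] in
/-- The coefficient map on underlying elements: `(coeffHom x : K) = algebraMap ℚ_p K x`. [folklore] -/
@[simp] theorem coe_coeffHom (x : ℤ_[p]) :
    ((coeffHom p K x : unitBall K) : K) = algebraMap ℚ_[p] K (x : ℚ_[p]) := rfl

omit [CompleteSpace K] in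
/-- The coefficient map is an isometry onto its image: `‖coeffHom x‖ = ‖x‖`. [folklore] -/
theorem norm_coe_coeffHom (x : ℤ_[p]) : ‖((coeffHom p K x : unitBall K) : K)‖ = ‖x‖ := by
  rw [coe_coeffHom, norm_algebraMap_padic]; rfl

omit [CompleteSpace K] in
/-- The coefficient map is continuous. [folklore] -/
theorem continuous_coeffHom : Continuous (coeffHom p K : ℤ_[p] → unitBall K) := by
  refine Continuous.subtype_mk ?_ _
  exact (continuous_algebraMap ℚ_[p] K).comp continuous_subtype_val

variable {p K}

omit [NormedAlgebra ℚ_[p] K] [CompleteSpace K] hp in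
/-- A point of the open unit disc is evaluable (topologically nilpotent in `𝒪_K`). [folklore] -/
theorem hasEval_of_norm_lt_one {t : unitBall K} (ht : ‖(t : K)‖ < 1) : PowerSeries.HasEval t :=
  (PowerSeries.hasEval_def t).mpr (isTopologicallyNilpotent_of_norm_lt_one K ht)

omit [NormedAlgebra ℚ_[p] K] [CompleteSpace K] hp in
/-- Finite families of points of the open unit disc are evaluable. [folklore] -/
theorem mvHasEval_of_norm_lt_one {τ : Type*} [Finite τ] {b : τ → unitBall K}
    (hb : ∀ i, ‖(b i : K)‖ < 1) : MvPowerSeries.HasEval b where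
  hpow i := isTopologicallyNilpotent_of_norm_lt_one K (hb i)
  tendsto_zero := by
    rw [(Filter.cofinite_eq_bot_iff.mpr ‹Finite τ›)]
    exact tendsto_bot

omit [NormedAlgebra ℚ_[p] K] [CompleteSpace K] hp in
/-- The pair `(u, v)` as an evaluable family on `Fin 2`. [folklore] -/
theorem hasEval_pair {u v : unitBall K} (hu : ‖(u : K)‖ < 1) (hv : ‖(v : K)‖ < 1) :
    MvPowerSeries.HasEval ![u, v] :=
  mvHasEval_of_norm_lt_one fun i => by fin_cases i <;> assumption

/-! ## §2 The evaluation homomorphisms and substitution -/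

variable (p K)

/-- **Evaluation of `ℤ_p`-series in several variables at an evaluable family `b`**, as a ring
homomorphism `MvPowerSeries τ ℤ_[p] →+* 𝒪_K` (Mathlib `MvPowerSeries.eval₂Hom` for the
continuous coefficient map `ℤ_p → 𝒪_K`). [cite: CasselsFrohlichANT1967, Ch. VI §3.2] -/
def ev {τ : Type*} (b : τ → unitBall K) (hb : MvPowerSeries.HasEval b) :
    MvPowerSeries τ ℤ_[p] →+* unitBall K :=
  MvPowerSeries.eval₂Hom (continuous_coeffHom p K) hb

/-- **Evaluation of one-variable `ℤ_p`-series at an evaluable point `t`** (`PowerSeries.eval₂Hom`).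
[cite: SilvermanAEC2009, IV.1] -/
def ev₁ (t : unitBall K) (ht : PowerSeries.HasEval t) : ℤ_[p]⟦X⟧ →+* unitBall K :=
  PowerSeries.eval₂Hom (continuous_coeffHom p K) ht

variable {p K}

/-- `ev` is Mathlib's `eval₂`. [folklore] -/
theorem ev_apply {τ : Type*} {b : τ → unitBall K} (hb : MvPowerSeries.HasEval b)
    (f : MvPowerSeries τ ℤ_[p]) : ev p K b hb f = MvPowerSeries.eval₂ (coeffHom p K) b f := by
  rw [ev, MvPowerSeries.coe_eval₂Hom]

/-- `ev₁` is Mathlib's `PowerSeries.eval₂`. [folklore] -/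
theorem ev₁_apply {t : unitBall K} (ht : PowerSeries.HasEval t) (f : ℤ_[p]⟦X⟧) :
    ev₁ p K t ht f = PowerSeries.eval₂ (coeffHom p K) t f := by
  rw [ev₁, PowerSeries.coe_eval₂Hom]

/-- `ev (X s) = b s`. [folklore] -/
@[simp] theorem ev_X {τ : Type*} {b : τ → unitBall K} (hb : MvPowerSeries.HasEval b) (s : τ) :
    ev p K b hb (MvPowerSeries.X s) = b s := by
  rw [ev_apply, MvPowerSeries.eval₂_X]

/-- `ev (C r) = φ r`. [folklore] -/
@[simp] theorem ev_C {τ : Type*} {b : τ → unitBall K} (hb : MvPowerSeries.HasEval b) (r : ℤ_[p]) :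
    ev p K b hb (MvPowerSeries.C r) = coeffHom p K r := by
  rw [ev_apply, MvPowerSeries.eval₂_C]

/-- `ev₁ X = t`. [folklore] -/
@[simp] theorem ev₁_X {t : unitBall K} (ht : PowerSeries.HasEval t) :
    ev₁ p K t ht PowerSeries.X = t := by
  rw [ev₁_apply, PowerSeries.eval₂_X]

/-- `ev₁ (C r) = φ r`. [folklore] -/
@[simp] theorem ev₁_C {t : unitBall K} (ht : PowerSeries.HasEval t) (r : ℤ_[p]) :
    ev₁ p K t ht (PowerSeries.C r) = coeffHom p K r := by
  rw [ev₁_apply, PowerSeries.eval₂_C]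

/-- `ev₁` is `ev` for the constant family (definitional bridge). [folklore] -/
theorem ev₁_eq_ev {t : unitBall K} (ht : PowerSeries.HasEval t) (f : ℤ_[p]⟦X⟧) :
    ev₁ p K t ht f = MvPowerSeries.eval₂ (coeffHom p K) (fun _ : Unit => t) f := by
  rw [ev₁_apply]; rfl

/-- **Evaluation commutes with substitution** (several variables): `(subst a f)(b) = f(a(b))`.
Both sides are continuous in `f` (substitution is continuous for any coefficient topology — the
tree's `mvPowerSeries_continuous_subst`) and agree on polynomials (Mathlib `eval₂_unique`).
[Bourbaki, Algèbre IV §4 no. 3, Prop. 4] [folklore] -/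
theorem ev_subst {σ τ : Type*} {a : σ → MvPowerSeries τ ℤ_[p]} (ha : MvPowerSeries.HasSubst a)
    {b : τ → unitBall K} (hb : MvPowerSeries.HasEval b) (f : MvPowerSeries σ ℤ_[p]) :
    ev p K b hb (MvPowerSeries.subst a f) =
      MvPowerSeries.eval₂ (coeffHom p K) (fun s => ev p K b hb (a s)) f := by
  have hφ := continuous_coeffHom p K
  have hc : Continuous (ev p K b hb) := by
    change Continuous (MvPowerSeries.eval₂Hom hφ hb)
    rw [MvPowerSeries.coe_eval₂Hom]
    exact MvPowerSeries.continuous_eval₂ hφ hb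
  have hb' : MvPowerSeries.HasEval fun s => ev p K b hb (a s) :=
    (ha.hasEval (S := ℤ_[p])).map hc
  have key := MvPowerSeries.eval₂_unique hφ hb'
    (ε := fun f => ev p K b hb (MvPowerSeries.subst a f))
    (hc.comp (mvPowerSeries_continuous_subst ha)) ?_
  · exact congr_fun key f
  · intro q
    rw [MvPowerSeries.subst_coe]
    induction q using MvPolynomial.induction_on with
    | C r =>
      rw [MvPolynomial.aeval_C, MvPolynomial.eval₂_C, MvPowerSeries.algebraMap_apply,
        Algebra.algebraMap_self, RingHom.id_apply, ev_C]
    | add f g hf hg => rw [map_add, MvPolynomial.eval₂_add, map_add, hf, hg]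
    | mul_X f s hf =>
      rw [map_mul, MvPolynomial.aeval_X, MvPolynomial.eval₂_mul, MvPolynomial.eval₂_X, map_mul, hf]

/-- The one-variable-into-several case: `(f.subst a)(b) = f(a(b))` for `f ∈ ℤ_p⟦X⟧`. [folklore] -/
theorem ev_powerSeries_subst {τ : Type*} {a : MvPowerSeries τ ℤ_[p]} (ha : PowerSeries.HasSubst a)
    {b : τ → unitBall K} (hb : MvPowerSeries.HasEval b) (f : ℤ_[p]⟦X⟧) :
    ev p K b hb (f.subst a) = PowerSeries.eval₂ (coeffHom p K) (ev p K b hb a) f :=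
  ev_subst (PowerSeries.HasSubst.const ha) hb f

/-- The same with the target written as `ev₁` at the (evaluable) value `a(b)`. [folklore] -/
theorem ev_powerSeries_subst' {τ : Type*} {a : MvPowerSeries τ ℤ_[p]} (ha : PowerSeries.HasSubst a)
    {b : τ → unitBall K} (hb : MvPowerSeries.HasEval b) (hab : PowerSeries.HasEval (ev p K b hb a))
    (f : ℤ_[p]⟦X⟧) : ev p K b hb (f.subst a) = ev₁ p K (ev p K b hb a) hab f := by
  rw [ev_powerSeries_subst ha hb, ev₁_apply]

/-- One variable into one variable: `(f ∘ g)(t) = f(g(t))` for `g(0) = 0`. [folklore] -/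
theorem ev₁_subst {g : ℤ_[p]⟦X⟧} (hg : PowerSeries.constantCoeff g = 0) {t : unitBall K}
    (ht : PowerSeries.HasEval t) (hgt : PowerSeries.HasEval (ev₁ p K t ht g)) (f : ℤ_[p]⟦X⟧) :
    ev₁ p K t ht (f.subst g) = ev₁ p K (ev₁ p K t ht g) hgt f := by
  have ha : PowerSeries.HasSubst g := PowerSeries.HasSubst.of_constantCoeff_zero' hg
  have hb : MvPowerSeries.HasEval (fun _ : Unit => t) := by
    refine ⟨fun _ => (PowerSeries.hasEval_def t).mp ht, ?_⟩
    rw [(Filter.cofinite_eq_bot_iff.mpr inferInstance)]; exact tendsto_bot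
  have h := ev_subst (K := K) (PowerSeries.HasSubst.const ha) hb f
  have e1 : ev p K (fun _ : Unit => t) hb = ev₁ p K t ht := by
    ext x : 1
    rw [ev_apply, ev₁_apply]; rfl
  rw [e1] at h
  rw [show f.subst g = MvPowerSeries.subst (fun _ : Unit => g) f from rfl, h, ev₁_apply (ht := hgt)]
  rfl

/-! ## §3 Values in `K`: the sum formula and bounds -/

/-- **The sum formula**: `ev₁ f t = ∑ₙ φ(fₙ) tⁿ` in `K`. [cite: SilvermanAEC2009, IV.1] -/
theorem hasSum_ev₁ {t : unitBall K} (ht : PowerSeries.HasEval t) (f : ℤ_[p]⟦X⟧) :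
    HasSum (fun n : ℕ => algebraMap ℚ_[p] K ((PowerSeries.coeff n f : ℤ_[p]) : ℚ_[p]) * (t : K) ^ n)
      ((ev₁ p K t ht f : unitBall K) : K) := by
  have h := (PowerSeries.hasSum_eval₂ (continuous_coeffHom p K) ht f).map (unitBall K).subtype
    continuous_subtype_val
  have e : (fun n : ℕ => algebraMap ℚ_[p] K ((PowerSeries.coeff n f : ℤ_[p]) : ℚ_[p]) * (t : K) ^ n) =
      (unitBall K).subtype ∘ fun n : ℕ => coeffHom p K (PowerSeries.coeff n f) * t ^ n := by
    funext n
    simp only [Function.comp_apply, Subring.coe_subtype, Subring.coe_mul, SubmonoidClass.coe_pow,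
      coe_coeffHom]
  rw [ev₁_apply, e]
  exact h

/-- `‖ev₁ f t‖ ≤ 1` (the value lies in `𝒪_K`). [folklore] -/
theorem norm_ev₁_le_one {t : unitBall K} (ht : PowerSeries.HasEval t) (f : ℤ_[p]⟦X⟧) :
    ‖((ev₁ p K t ht f : unitBall K) : K)‖ ≤ 1 :=
  (mem_unitBall_iff K).mp (ev₁ p K t ht f).2

/-- **`‖f(t)‖ ≤ ‖t‖` when `f(0) = 0`** (every term `φ(fₙ)tⁿ`, `n ≥ 1`, has norm `≤ ‖t‖`).
[cite: SilvermanAEC2009, IV.1] -/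
theorem norm_ev₁_le {t : unitBall K} (ht : PowerSeries.HasEval t) (ht1 : ‖(t : K)‖ ≤ 1)
    {f : ℤ_[p]⟦X⟧} (hf0 : PowerSeries.constantCoeff f = 0) :
    ‖((ev₁ p K t ht f : unitBall K) : K)‖ ≤ ‖(t : K)‖ := by
  rw [← (hasSum_ev₁ ht f).tsum_eq]
  refine IsUltrametricDist.norm_tsum_le_of_forall_le_of_nonneg (norm_nonneg _) fun n => ?_
  rcases Nat.eq_zero_or_pos n with rfl | hn
  · rw [PowerSeries.coeff_zero_eq_constantCoeff, hf0]; simp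
  · rw [norm_mul, norm_pow, norm_algebraMap_padic]
    calc ‖((PowerSeries.coeff n f : ℤ_[p]) : ℚ_[p])‖ * ‖(t : K)‖ ^ n ≤ 1 * ‖(t : K)‖ ^ 1 := by
          refine mul_le_mul (PadicInt.norm_le_one _) ?_ (pow_nonneg (norm_nonneg _) _) zero_le_one
          exact pow_le_pow_of_le_one (norm_nonneg _) ht1 hn
      _ = ‖(t : K)‖ := by rw [one_mul, pow_one]

/-- `‖ev F (u, v)‖ ≤ 1`. [folklore] -/
theorem norm_ev_le_one {τ : Type*} {b : τ → unitBall K} (hb : MvPowerSeries.HasEval b)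
    (F : MvPowerSeries τ ℤ_[p]) : ‖((ev p K b hb F : unitBall K) : K)‖ ≤ 1 :=
  (mem_unitBall_iff K).mp (ev p K b hb F).2

/-- **The sum formula, several variables**: `ev F b = ∑_d φ(F_d) ∏ (b s)^{d s}` in `K`. [folklore] -/
theorem hasSum_ev {τ : Type*} {b : τ → unitBall K} (hb : MvPowerSeries.HasEval b)
    (F : MvPowerSeries τ ℤ_[p]) :
    HasSum (fun d : τ →₀ ℕ => algebraMap ℚ_[p] K ((MvPowerSeries.coeff d F : ℤ_[p]) : ℚ_[p]) *
        d.prod fun s e => ((b s : unitBall K) : K) ^ e)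
      ((ev p K b hb F : unitBall K) : K) := by
  have h := (MvPowerSeries.hasSum_eval₂ (continuous_coeffHom p K) hb F).map (unitBall K).subtype
    continuous_subtype_val
  have e : (fun d : τ →₀ ℕ => algebraMap ℚ_[p] K ((MvPowerSeries.coeff d F : ℤ_[p]) : ℚ_[p]) *
        d.prod fun s e => ((b s : unitBall K) : K) ^ e) =
      (unitBall K).subtype ∘ fun d : τ →₀ ℕ =>
        coeffHom p K (MvPowerSeries.coeff d F) * d.prod fun s e => b s ^ e := by
    funext d
    simp only [Function.comp_apply, Subring.coe_subtype, Subring.coe_mul, coe_coeffHom, Finsupp.prod,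
      SubmonoidClass.coe_finsetProd, SubmonoidClass.coe_pow]
  rw [ev_apply, e]
  exact h

/-- **`‖F(b)‖ ≤ max ‖b s‖` when `F(0) = 0`** (finite index type, all `‖b s‖ ≤ 1`): every term of
the sum formula with `d ≠ 0` contains a factor `b s`. [cite: SilvermanAEC2009, IV.1] -/
theorem norm_ev_le_of_constantCoeff_eq_zero {τ : Type*} [Fintype τ] [Nonempty τ]
    {b : τ → unitBall K} (hb : MvPowerSeries.HasEval b) {F : MvPowerSeries τ ℤ_[p]}
    (hF0 : MvPowerSeries.constantCoeff F = 0) :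
    ‖((ev p K b hb F : unitBall K) : K)‖ ≤ Finset.univ.sup' Finset.univ_nonempty fun s => ‖(b s : K)‖ := by
  set r := Finset.univ.sup' Finset.univ_nonempty fun s => ‖(b s : K)‖ with hr
  have hr0 : 0 ≤ r := by
    obtain ⟨s⟩ := ‹Nonempty τ›
    exact (norm_nonneg _).trans (Finset.le_sup' (fun s => ‖(b s : K)‖) (Finset.mem_univ s))
  have hbs : ∀ s, ‖(b s : K)‖ ≤ r := fun s => Finset.le_sup' (fun s => ‖(b s : K)‖) (Finset.mem_univ s)
  have hb1 : ∀ s, ‖(b s : K)‖ ≤ 1 := fun s => (mem_unitBall_iff K).mp (b s).2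
  rw [← (hasSum_ev hb F).tsum_eq]
  refine IsUltrametricDist.norm_tsum_le_of_forall_le_of_nonneg hr0 fun d => ?_
  by_cases hd : d = 0
  · subst hd
    rw [MvPowerSeries.coeff_zero_eq_constantCoeff, hF0]; simp [hr0]
  · obtain ⟨s, hs⟩ := Finsupp.ne_iff.mp hd
    rw [norm_mul, norm_algebraMap_padic]
    have hprod : ‖d.prod fun s e => ((b s : unitBall K) : K) ^ e‖ ≤ r := by
      rw [Finsupp.prod, ← Finset.prod_erase_mul _ _ (Finsupp.mem_support_iff.mpr hs), norm_mul]
      have h1 : ‖∏ x ∈ d.support.erase s, ((b x : unitBall K) : K) ^ d x‖ ≤ 1 := by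
        rw [norm_prod]
        exact Finset.prod_le_one (fun _ _ => norm_nonneg _) fun x _ => by
          rw [norm_pow]; exact pow_le_one₀ (norm_nonneg _) (hb1 x)
      have h2 : ‖((b s : unitBall K) : K) ^ d s‖ ≤ r := by
        rw [norm_pow]
        simp only [Finsupp.coe_zero, Pi.zero_apply, ne_eq] at hs
        calc ‖(b s : K)‖ ^ d s ≤ ‖(b s : K)‖ ^ 1 :=
              pow_le_pow_of_le_one (norm_nonneg _) (hb1 s) (Nat.pos_of_ne_zero hs)
          _ ≤ r := by rw [pow_one]; exact hbs s
      calc _ ≤ 1 * r := mul_le_mul h1 h2 (norm_nonneg _) zero_le_one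
        _ = r := one_mul r
    calc _ ≤ 1 * r := mul_le_mul (PadicInt.norm_le_one _) hprod (norm_nonneg _) zero_le_one
      _ = r := one_mul r

end BallEval

end Summit.BirchSwinnertonDyer.Rank1Residual.Additive

end
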